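import Mathlib.Combinatorics.SimpleGraph.Walk.Counting
import Mathlib.Combinatorics.SimpleGraph.Paths
import Mathlib.Combinatorics.SimpleGraph.DeleteEdges
import Mathlib.Topology.Algebra.InfiniteSum.ENNReal
import Summits.CriticalPhenomena.SAWScalingLimit.Theorems.SAWTotalPositivityBoundaryTP2Defs
import Summits.CriticalPhenomena.SAWScalingLimit.Theorems.SAWTotalPositivityBoundaryTP2Kernel
import Summits.CriticalPhenomena.SAWScalingLimit.Theorems.SAWTotalPositivityBoundaryTP2Symmetry
import Summits.CriticalPhenomena.SAWScalingLimit.Theorems.SAWTotalPositivityBoundaryTP2Avoid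
import HarnessLib

/-!
# Crux `LeftRightFKG` (stmt-CriticalPhenomena-11232), line `corner-localisation` (v8):
paths through a vertex of degree two (`stub_visitDeg2`)

The one combinatorial identity used by all the gadgets of the line. Let `G` be a graph and `c` a vertex
whose neighbours are among `{s, r}`, with `s ∼ c`, `c ∼ r`, `s ≠ r`, and let `t ≠ c`. A self-avoiding
path `γ : s → t` of `G` that visits `c` is `s c r · δ`: its second vertex is `c` (otherwise `c` would occur
later on the path with a predecessor and a successor, two distinct neighbours of `c` different from the
starting point `s`, i.e. both equal to `r`), its third vertex is the other neighbour `r`, and the remainder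
`δ : r → t` avoids `c` and `s`, i.e. is a self-avoiding path of
`G' = G.deleteEdges (G.incidenceSet c ∪ G.incidenceSet s)` (both `c` and `s` isolated). Conversely
`s c r · δ` is such a path for every self-avoiding `G'`-path `δ : r → t`. The bijection `δ ↦ s c r · δ` adds
`2` to the length, whence the identity of fugacity-`x` path kernels (`0 ≤ x`)

  `pathKernelOn G x s t {γ | c ∈ γ} = x² · pathKernel G' x r t`

(`pathKernelOn_visit_of_adj`, general vertex type; `stub_visitDeg2` is the registered `Site 2` statement
with the hypothesis `G.neighborSet c = {s, r}`). Everything here is proved from Mathlib's `SimpleGraph.Walk`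
API (`takeUntil`/`dropUntil`, `toDeleteEdges`, `mapLe`) and `Function.Injective.tsum_eq`; no named facts
are used. [folklore]
-/

noncomputable section

open Literature.Probability.LatticeModels
open Summit.CriticalPhenomena.SAWScalingLimit.Theorems.BoundaryTP2
open scoped ENNReal

namespace Summit.CriticalPhenomena.SAWScalingLimit.Theorems.LeftRightFKG.CornerGadget

variable {V : Type*}

/-! ## Walk bookkeeping -/

/-- A walk between distinct vertices leaves its starting point along an edge towards a vertex of its
tail. [folklore] -/
private theorem exists_adj_mem_tail_of_ne {G : SimpleGraph V} {a b : V} (w : G.Walk a b)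
    (hab : a ≠ b) : ∃ y, G.Adj a y ∧ y ∈ w.support.tail := by
  cases w with
  | nil => exact absurd rfl hab
  | cons h w' => exact ⟨_, h, w'.start_mem_support⟩

/-- A walk between distinct vertices enters its end point along an edge from one of its vertices.
[folklore] -/
private theorem exists_adj_end_mem_support_of_ne {G : SimpleGraph V} {a b : V} (w : G.Walk a b)
    (hab : a ≠ b) : ∃ y, G.Adj b y ∧ y ∈ w.support := by
  obtain ⟨y, hy, hmem⟩ := exists_adj_mem_tail_of_ne w.reverse hab.symm
  refine ⟨y, hy, ?_⟩
  have hmem' := List.mem_of_mem_tail hmem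
  rwa [SimpleGraph.Walk.support_reverse, List.mem_reverse] at hmem'

/-- If every neighbour of `c` is `s` or `r`, then a self-avoiding path between two vertices different from
`c` that avoids `s` also avoids `c`: otherwise the predecessor and the successor of `c` on the path are two
distinct neighbours of `c` different from `s`, i.e. both equal to `r`. [folklore] -/
private theorem not_mem_support_of_isPath {G : SimpleGraph V} {c s r : V}
    (hnb : ∀ y, G.Adj c y → y = s ∨ y = r) {u v : V} (p : G.Walk u v) (hp : p.IsPath)
    (hu : u ≠ c) (hv : v ≠ c) (hs : s ∉ p.support) : c ∉ p.support := by
  classical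
  intro hc
  obtain ⟨y, hy, hymem⟩ := exists_adj_end_mem_support_of_ne (p.takeUntil c hc) hu
  obtain ⟨y', hy', hy'mem⟩ := exists_adj_mem_tail_of_ne (p.dropUntil c hc) hv.symm
  have hmem_take : ∀ z ∈ (p.takeUntil c hc).support, z ∈ p.support :=
    fun z hz => SimpleGraph.Walk.support_takeUntil_subset_support p hc hz
  have hmem_drop : ∀ z ∈ (p.dropUntil c hc).support.tail, z ∈ p.support :=
    fun z hz => SimpleGraph.Walk.support_dropUntil_subset_support p hc (List.mem_of_mem_tail hz)
  have hnodup : ((p.takeUntil c hc).support ++ (p.dropUntil c hc).support.tail).Nodup := by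
    rw [← SimpleGraph.Walk.support_append, SimpleGraph.Walk.take_spec]
    exact hp.support_nodup
  have h1 : y = r := (hnb y hy).resolve_left fun hys => hs (hys ▸ hmem_take y hymem)
  have h2 : y' = r := (hnb y' hy').resolve_left fun hys => hs (hys ▸ hmem_drop y' hy'mem)
  rw [h1] at hymem
  rw [h2] at hy'mem
  exact List.disjoint_of_nodup_append hnodup hymem hy'mem

/-- **Structure of the paths through `c`.** If `s ∼ c ∼ r`, every neighbour of `c` is `s` or `r`, and
`t ≠ c`, then a self-avoiding path `s → t` visiting `c` is `s c r · q` for a walk `q : r → t`. [folklore] -/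
private theorem eq_cons_cons_of_mem_support {G : SimpleGraph V} {c s r t : V}
    (hsc : G.Adj s c) (hcr : G.Adj c r) (hnb : ∀ y, G.Adj c y → y = s ∨ y = r) (htc : t ≠ c)
    (p : G.Walk s t) (hp : p.IsPath) (hc : c ∈ p.support) :
    ∃ q : G.Walk r t, p = SimpleGraph.Walk.cons hsc (SimpleGraph.Walk.cons hcr q) := by
  cases p with
  | nil =>
    rw [SimpleGraph.Walk.support_nil, List.mem_singleton] at hc
    exact absurd hc.symm hsc.ne
  | @cons _ v₁ _ h p₁ =>
    rw [SimpleGraph.Walk.cons_isPath_iff] at hp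
    rw [SimpleGraph.Walk.support_cons, List.mem_cons] at hc
    have hc₁ : c ∈ p₁.support := hc.resolve_left fun h' => hsc.ne h'.symm
    rcases eq_or_ne v₁ c with hv₁ | hv₁
    · subst hv₁
      cases p₁ with
      | nil => exact absurd rfl htc
      | cons h' p₂ =>
        rw [SimpleGraph.Walk.cons_isPath_iff] at hp
        rcases hnb _ h' with hvs | hvr
        · subst hvs
          exact absurd (List.Mem.tail _ p₂.start_mem_support) hp.2
        · subst hvr
          exact ⟨p₂, rfl⟩
    · exact absurd hc₁ (not_mem_support_of_isPath hnb p₁ hp.1 hv₁ htc hp.2)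

/-! ## The doubly vertex-deleted graph `G - c - s` -/

/-- Adjacency of `G.deleteEdges (G.incidenceSet c ∪ G.incidenceSet s)`: the edges of `G` avoiding both
`c` and `s`. [folklore] -/
theorem deleteEdges_incidenceSet_union_adj (G : SimpleGraph V) (c s a b : V) :
    (G.deleteEdges (G.incidenceSet c ∪ G.incidenceSet s)).Adj a b ↔
      G.Adj a b ∧ a ≠ c ∧ b ≠ c ∧ a ≠ s ∧ b ≠ s := by
  rw [SimpleGraph.deleteEdges_adj, Set.mem_union, SimpleGraph.mk'_mem_incidenceSet_iff,
    SimpleGraph.mk'_mem_incidenceSet_iff]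
  tauto

/-- A walk of `G.deleteEdges (G.incidenceSet c ∪ G.incidenceSet s)` starting at a vertex `r ≠ c, s`
visits neither `c` nor `s` (both are isolated there). [folklore] -/
private theorem not_mem_support_of_walk_deleteEdges_union {G : SimpleGraph V} {c s r t : V}
    (hrc : r ≠ c) (hrs : r ≠ s)
    (δ : (G.deleteEdges (G.incidenceSet c ∪ G.incidenceSet s)).Walk r t) :
    c ∉ δ.support ∧ s ∉ δ.support := by
  have key : ∀ v ∈ δ.support, v ≠ c ∧ v ≠ s := by
    intro v hv
    rcases mem_support_walk δ v hv with rfl | hv'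
    · exact ⟨hrc, hrs⟩
    · obtain ⟨w, hw⟩ := (SimpleGraph.mem_support _).1 hv'
      rw [deleteEdges_incidenceSet_union_adj] at hw
      exact ⟨hw.2.1, hw.2.2.2.1⟩
  exact ⟨fun h => (key c h).1 rfl, fun h => (key s h).2 rfl⟩

/-- For `s ∼ c ∼ r`, `s ≠ r` and a self-avoiding path `δ : r → t` of `G - c - s`, the walk `s c r · δ` is a
self-avoiding path of `G`. [folklore] -/
private theorem consCons_isPath {G : SimpleGraph V} {c s r t : V} (hsc : G.Adj s c) (hcr : G.Adj c r)
    (hsr : s ≠ r) (δ : (G.deleteEdges (G.incidenceSet c ∪ G.incidenceSet s)).Path r t) :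
    (SimpleGraph.Walk.cons hsc (SimpleGraph.Walk.cons hcr
      (δ.1.mapLe (G.deleteEdges_le _)))).IsPath := by
  obtain ⟨hc, hs⟩ := not_mem_support_of_walk_deleteEdges_union hcr.ne.symm hsr.symm δ.1
  rw [SimpleGraph.Walk.cons_isPath_iff, SimpleGraph.Walk.cons_isPath_iff,
    SimpleGraph.Walk.support_mapLe_eq_support, SimpleGraph.Walk.support_cons,
    SimpleGraph.Walk.support_mapLe_eq_support, List.mem_cons, not_or]
  exact ⟨⟨δ.2.mapLe _, hc⟩, hsc.ne, hs⟩

/-! ## The kernel identity -/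

/-- **Paths through a vertex of degree (at most) two.** Let `s ∼ c ∼ r` with `s ≠ r`, every neighbour of
`c` equal to `s` or `r`, `t ≠ c` and `0 ≤ x`. Then
`Σ_{γ : s → t self-avoiding, c ∈ γ} x^{|γ|} = x² · Z_{G - c - s}(r, t)`, where `G - c - s` is
`G.deleteEdges (G.incidenceSet c ∪ G.incidenceSet s)`: the paths through `c` are exactly `s c r · δ` for
the self-avoiding paths `δ : r → t` of `G - c - s`. [folklore] -/
theorem pathKernelOn_visit_of_adj (G : SimpleGraph V) (x : ℝ) {c s r t : V} (hx : 0 ≤ x)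
    (hsc : G.Adj s c) (hcr : G.Adj c r) (hnb : ∀ y, G.Adj c y → y = s ∨ y = r) (hsr : s ≠ r)
    (htc : t ≠ c) :
    pathKernelOn G x s t {γ | c ∈ γ.1.support} =
      ENNReal.ofReal (x ^ 2) *
        pathKernel (G.deleteEdges (G.incidenceSet c ∪ G.incidenceSet s)) x r t := by
  let Φ : (G.deleteEdges (G.incidenceSet c ∪ G.incidenceSet s)).Path r t → G.Path s t := fun δ =>
    ⟨SimpleGraph.Walk.cons hsc (SimpleGraph.Walk.cons hcr (δ.1.mapLe (G.deleteEdges_le _))),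
      consCons_isPath hsc hcr hsr δ⟩
  have hΦmem : ∀ δ, Φ δ ∈ {γ : G.Path s t | c ∈ γ.1.support} := fun δ =>
    List.Mem.tail _ (List.Mem.head _)
  have hΦinj : Function.Injective Φ := by
    intro δ δ' h
    have h1 := congrArg Subtype.val h
    simp only [Φ, SimpleGraph.Walk.cons.injEq, heq_eq_eq, true_and] at h1
    exact Subtype.ext
      (SimpleGraph.Walk.map_injective_of_injective (by exact Function.injective_id) r t h1)
  have hrange : Function.support
      ({γ : G.Path s t | c ∈ γ.1.support}.indicator fun γ => ENNReal.ofReal (x ^ γ.1.length)) ⊆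
        Set.range Φ := by
    intro γ hγ
    have hγS : γ ∈ {γ : G.Path s t | c ∈ γ.1.support} := Set.mem_of_indicator_ne_zero hγ
    obtain ⟨q, hq⟩ := eq_cons_cons_of_mem_support hsc hcr hnb htc γ.1 γ.2 hγS
    have hpath := γ.2
    rw [hq, SimpleGraph.Walk.cons_isPath_iff, SimpleGraph.Walk.cons_isPath_iff] at hpath
    have hqs : s ∉ q.support := fun h => hpath.2 (List.Mem.tail _ h)
    have hq_edges : ∀ e, e ∈ q.edges → e ∉ G.incidenceSet c ∪ G.incidenceSet s := by
      rintro e he (hmem | hmem)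
      · exact hpath.1.2 (SimpleGraph.Walk.mem_support_of_mem_edges he hmem.2)
      · exact hqs (SimpleGraph.Walk.mem_support_of_mem_edges he hmem.2)
    refine ⟨⟨q.toDeleteEdges _ hq_edges, hpath.1.1.toDeleteEdges _ _ _⟩, Subtype.ext ?_⟩
    simp only [Φ, SimpleGraph.Walk.mapLe, SimpleGraph.Walk.map_toDeleteEdges_eq]
    exact hq.symm
  have hlen : ∀ δ : (G.deleteEdges (G.incidenceSet c ∪ G.incidenceSet s)).Path r t,
      (δ.1.mapLe (G.deleteEdges_le _)).length = δ.1.length := fun δ =>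
    SimpleGraph.Walk.length_map _ _
  have key := hΦinj.tsum_eq
    (f := {γ : G.Path s t | c ∈ γ.1.support}.indicator fun γ => ENNReal.ofReal (x ^ γ.1.length))
    hrange
  calc pathKernelOn G x s t {γ | c ∈ γ.1.support}
      = ∑' δ, ({γ : G.Path s t | c ∈ γ.1.support}.indicator
          fun γ => ENNReal.ofReal (x ^ γ.1.length)) (Φ δ) := key.symm
    _ = ∑' δ : (G.deleteEdges (G.incidenceSet c ∪ G.incidenceSet s)).Path r t,
          ENNReal.ofReal (x ^ 2) * ENNReal.ofReal (x ^ δ.1.length) := by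
        refine tsum_congr fun δ => ?_
        rw [Set.indicator_of_mem (hΦmem δ)]
        simp only [Φ, SimpleGraph.Walk.length_cons, hlen]
        rw [← ENNReal.ofReal_mul (pow_nonneg hx 2), ← pow_add]
        congr 1
        ring
    _ = ENNReal.ofReal (x ^ 2) *
          pathKernel (G.deleteEdges (G.incidenceSet c ∪ G.incidenceSet s)) x r t :=
        ENNReal.tsum_mul_left

/-- **Registered stub `stub_visitDeg2` (paths through a degree-2 vertex).** If `N_G(c) = {s, r}` with
`s ≠ r`, then for `t ≠ c` (and `t ≠ s`) the self-avoiding paths `s → t` of `G` visiting `c` are exactly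
`s c r · δ` with `δ : r → t` a self-avoiding path of `G - c - s = G.deleteEdges (G.incidenceSet c ∪
G.incidenceSet s)`, so their fugacity-`x` kernel is `x² · Z_{G-c-s}(r, t)` (`0 ≤ x`). [folklore] -/
theorem stub_visitDeg2 : ∀ (G : SimpleGraph (Site 2)) (x : ℝ) (c s r t : Site 2), 0 ≤ x →
    G.neighborSet c = {s, r} → s ≠ r → t ≠ c → t ≠ s →
    pathKernelOn G x s t {γ | c ∈ γ.1.support} =
      ENNReal.ofReal (x ^ 2) * pathKernel (G.deleteEdges (G.incidenceSet c ∪ G.incidenceSet s)) x r t := by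
  intro G x c s r t hx hN hsr htc _
  have hcs : G.Adj c s := by
    rw [← SimpleGraph.mem_neighborSet, hN]
    exact Set.mem_insert _ _
  have hcr : G.Adj c r := by
    rw [← SimpleGraph.mem_neighborSet, hN]
    exact Set.mem_insert_of_mem _ (Set.mem_singleton _)
  have hnb : ∀ y, G.Adj c y → y = s ∨ y = r := by
    intro y hy
    have hy' : y ∈ G.neighborSet c := hy
    rw [hN] at hy'
    simpa only [Set.mem_insert_iff, Set.mem_singleton_iff] using hy'
  exact pathKernelOn_visit_of_adj G x hx hcs.symm hcr hnb hsr htc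

end Summit.CriticalPhenomena.SAWScalingLimit.Theorems.LeftRightFKG.CornerGadget
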